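import Summits.PneNP.PneNP.Theorems.ChebyshevTracialDesignAllDirections
import Summits.PneNP.PneNP.Theorems.ChebyshevTracialDesignJuntaAmplitudeOne
import Summits.PneNP.PneNP.Theorems.ChebyshevTracialDesignContainmentReduction
import HarnessLib

/-!
# Cell pnp-psdrank, route `ChebyshevTracialDesign`: THE 𝒜₁ RUNG WITH `H`-SYMMETRIC AMPLITUDES IS UNCONDITIONAL — the crux's value bound for the psd
# strategies `X_U = ψ(|U∩H|)·B_UB_Uᵀ` (`deg B = 1`, `B_UB_Uᵀ ⪯ I`) against EVERY psd contraction field `Y`, at EVERY dimension `r` — brick 146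
# (crux `TracialDecayExp20`, stmt-PneNP-19878)

Brick 146 (prover g29; MEMO-32 §3). MEMO-21 §3(b) built the first r-free rung above NTF by name: CG_1 (per matching,
`Σ_U W(U,M) f(U)(Σ_p g_p x_p)² ≤ ε_M·Σ_p g_p²` for every `g`) ⟹ the crux's value on the amplitude class `𝒜₁ = {X_U = f(U)·B_UB_Uᵀ : B_U = Σ_p x_pβ_p}`
is `≤ (Σ_M ε_M₊)·r·n(n−1)/(t(n−t))` (bricks 106/108, `…DegreeOneFrobeniusMass.value_amplitudeOne_le_of_CG1_dim`); brick 115 discharged CG_1 for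
JUNTA amplitudes. Here CG_1 is discharged for the `H`-SYMMETRIC amplitudes `f = ψ(|U∩H|)` (`|H| = n/2`, `0 ≤ ψ ≤ G`):
* §1 `exists_cube_max`, `continuous_linearForm`, **`CG1_of_cubeMax`** — per matching, `ε_M :=` the maximum of `V_M(g) = Σ_U W f (Σ_p g_px_p)²` over the
  cube `[−1,1]^n` (compactness) satisfies CG_1 by `2`-homogeneity (`g/‖g‖₂` lies in the cube); `containment_pairSymm` (the containment form only sees
  the pair-symmetrisation of a direction);
* §2 **`hSymmetric_amplitudeOne_value_le`** — `Σ_M ε_M = Σ_M V_M(g*_M)` for the maximising field `g*`; brick 101 (`value_sq_sub_containment_abs_le`)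
  trades the linear forms for containment forms at cost `3n⁴·20·√P_{dq n−4}`, and brick 145 (`allDirections_designValue_le`) bounds the containment
  forms for every field; with brick 108: for some `a > 0` and all large even `n`, every balanced exact design of the crux's shape, every balanced
  block, every `0 ≤ ψ ≤ G`, every degree-one contraction factor `B` and every psd contraction field `Y`:
  `Σ_{U,M} W(U,M)·ψ(|U∩H|)·tr(B_UB_UᵀY_M) ≤ 6·10⁷·G·n⁶·(e^{−a·dq n} + 2^{−⌊n/40⌋} + √P_{dq n−4})·r`,
  `P_k = Π_{i ≤ k/2} (2i+1)/(n−2i)` the cell's attenuation product (`≈ (k/n)^{k/2}`); the next file (brick 146c) quotes it at the crux's own scale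
  `≤ 2·10⁸·G·n⁶·e^{−a·dq n}·r` (brick 146b: both auxiliary scales are eventually `≤ e^{−a·dq n}`).
READING: the crux's inequality, up to the factor `poly(n)·(e^{−a dq n} + 2^{−n/40} + √P)` in place of `e^{−a dq n}`, for a class of NON-junta,
NON-equivariant psd strategies of UNBOUNDED dimension (the `X`-side an `H`-symmetric mask times a degree-one Gram contraction, the `Y`-side arbitrary);
tightness is not even used. ASYMPTOTIC ONLY. WHAT THIS FILE DOES NOT DO: spread (non-`H`-symmetric) amplitudes, factors of degree `> 1`, unbalanced
blocks — nothing on `TracialDecayExp20` itself beyond this class, psd rank of P_PM(K_n), or P vs NP.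
[cite: GriblingDelaatLaurent2019, §5] [cite: Rothvoss2017, §2 and Lemma 7 (PDF pp. 5–8)] [cite: BrietDadushPokutta2014, Thm. 6 (§3)]
[cite: KeevashLifshitz2023, Thm. 1.8]
Stature: support/instrument (kernel lane, no defs, axioms standard) — a RUNG-type statement for a named strategy class. Supports stmt-PneNP-19878.
-/

set_option linter.dupNamespace false -- `Summit.PneNP.PneNP.…`: summit = sub-problem (D-0017)

noncomputable section

namespace Summit.PneNP.PneNP.Theorems.ChebyshevTracialDesignHSymmetricAmplitudeOne

open Finset Matrix Literature.Barriers.PneNP Literature.Combinatorics.Optimization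
open Summit.PneNP.PneNP.Theorems.ChebyshevTracialDesignDegreeOneFrobeniusMass (value_amplitudeOne_le_of_CG1_dim)
open Summit.PneNP.PneNP.Theorems.ChebyshevTracialDesignContainmentReduction (value_sq_sub_containment_abs_le)
open Summit.PneNP.PneNP.Theorems.ChebyshevTracialDesignAllDirections (allDirections_designValue_le)
open Summit.PneNP.PneNP.Theorems.ChebyshevTracialDesignCrossingPlaneAverage (dq_Tq_facts)

variable {n : ℕ}

/-! ### §1 CG_1 from the cube maximum -/

/-- The cube `[−1,1]^n` is compact, so a continuous function attains its maximum on it. [folklore] -/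
theorem exists_cube_max (V : (Fin n → ℝ) → ℝ) (hV : Continuous V) :
    ∃ g₀ : Fin n → ℝ, (∀ p, |g₀ p| ≤ 1) ∧ ∀ g : Fin n → ℝ, (∀ p, |g p| ≤ 1) → V g ≤ V g₀ := by
  have hK : IsCompact (Set.pi Set.univ fun _ : Fin n => Set.Icc (-1 : ℝ) 1) := isCompact_univ_pi fun _ => isCompact_Icc
  have hne : (Set.pi Set.univ fun _ : Fin n => Set.Icc (-1 : ℝ) 1).Nonempty :=
    ⟨0, fun p _ => by simp⟩
  obtain ⟨g₀, hg₀, hmax⟩ := hK.exists_isMaxOn hne hV.continuousOn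
  refine ⟨g₀, fun p => abs_le.2 (by simpa using hg₀ p (Set.mem_univ p)), fun g hg => hmax ?_⟩
  exact fun p _ => by simpa using abs_le.1 (hg p)

/-- The linear design form `V_M(g) = Σ_U W(U,M) f(U)(Σ_p g_p x_p)²` is continuous in `g`. [folklore] -/
theorem continuous_linearForm (W : OddSet n → PMatch n → ℝ) (M : PMatch n) (f : OddSet n → ℝ) :
    Continuous fun g : Fin n → ℝ => ∑ U : OddSet n, W U M * (f U * (∑ p, g p * (if p ∈ U.1 then (1 : ℝ) else 0)) ^ 2) := by
  fun_prop

/-- **CG_1 from a cube maximiser, by homogeneity**: if `g₀ ∈ [−1,1]^n` maximises `V_M` on the cube then `V_M(g) ≤ V_M(g₀)·Σ_p g_p²` for EVERY `g`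
(`g/‖g‖₂` lies in the cube and `V_M` is `2`-homogeneous). [folklore] -/
theorem CG1_of_cubeMax (W : OddSet n → PMatch n → ℝ) (M : PMatch n) (f : OddSet n → ℝ) (g₀ : Fin n → ℝ)
    (hmax : ∀ g : Fin n → ℝ, (∀ p, |g p| ≤ 1) →
      ∑ U : OddSet n, W U M * (f U * (∑ p, g p * (if p ∈ U.1 then (1 : ℝ) else 0)) ^ 2) ≤
        ∑ U : OddSet n, W U M * (f U * (∑ p, g₀ p * (if p ∈ U.1 then (1 : ℝ) else 0)) ^ 2))
    (g : Fin n → ℝ) :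
    ∑ U : OddSet n, W U M * (f U * (∑ p, g p * (if p ∈ U.1 then (1 : ℝ) else 0)) ^ 2) ≤
      (∑ U : OddSet n, W U M * (f U * (∑ p, g₀ p * (if p ∈ U.1 then (1 : ℝ) else 0)) ^ 2)) * ∑ p, g p ^ 2 := by
  obtain ⟨s, hs⟩ : ∃ s : ℝ, s = ∑ p, g p ^ 2 := ⟨_, rfl⟩
  have hs0 : 0 ≤ s := by rw [hs]; positivity
  rcases eq_or_lt_of_le hs0 with h0 | hpos
  · -- `g = 0`
    have hg : ∀ p, g p = 0 := fun p => by
      have := (sum_eq_zero_iff_of_nonneg (fun q _ => sq_nonneg (g q))).1 (by rw [← hs, ← h0]) p (mem_univ p)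
      exact pow_eq_zero_iff (n := 2) (by norm_num) |>.1 this
    rw [← hs, ← h0, mul_zero]
    simp [hg]
  · -- rescale to the cube
    have hsq : Real.sqrt s ^ 2 = s := Real.sq_sqrt hs0
    have hsqpos : 0 < Real.sqrt s := Real.sqrt_pos.2 hpos
    have hcube : ∀ p, |g p / Real.sqrt s| ≤ 1 := by
      intro p
      rw [abs_div, abs_of_pos hsqpos, div_le_one hsqpos]
      have hp : g p ^ 2 ≤ s := by rw [hs]; exact single_le_sum (f := fun q => g q ^ 2) (fun q _ => sq_nonneg _) (mem_univ p)
      calc |g p| = Real.sqrt (g p ^ 2) := (Real.sqrt_sq_eq_abs _).symm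
        _ ≤ Real.sqrt s := Real.sqrt_le_sqrt hp
    have key := hmax (fun p => g p / Real.sqrt s) hcube
    have hhom : ∑ U : OddSet n, W U M * (f U * (∑ p, g p * (if p ∈ U.1 then (1 : ℝ) else 0)) ^ 2) =
        s * ∑ U : OddSet n, W U M * (f U * (∑ p, g p / Real.sqrt s * (if p ∈ U.1 then (1 : ℝ) else 0)) ^ 2) := by
      rw [mul_sum]
      refine Fintype.sum_congr _ _ fun U => ?_
      have : ∑ p, g p * (if p ∈ U.1 then (1 : ℝ) else 0) = Real.sqrt s * ∑ p, g p / Real.sqrt s * (if p ∈ U.1 then (1 : ℝ) else 0) := by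
        rw [mul_sum]; refine sum_congr rfl fun p _ => ?_
        rw [show Real.sqrt s * (g p / Real.sqrt s * (if p ∈ U.1 then (1 : ℝ) else 0)) =
          Real.sqrt s / Real.sqrt s * (g p * (if p ∈ U.1 then (1 : ℝ) else 0)) by ring, div_self hsqpos.ne', one_mul]
      rw [this, mul_pow, hsq]; ring
    rw [hhom, ← hs, mul_comm]
    exact mul_le_mul_of_nonneg_right key hs0

/-- Pair symmetrisation leaves the containment form unchanged: `Σ_p v_p x_px_{πp} = Σ_p ((v_p + v_{πp})/2) x_px_{πp}`. [folklore] -/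
theorem containment_pairSymm (M : PMatch n) (U : Finset (Fin n)) (v : Fin n → ℝ) :
    ∑ p, v p * ((if p ∈ U then (1 : ℝ) else 0) * (if M.2.partner p ∈ U then (1 : ℝ) else 0)) =
      ∑ p, (v p + v (M.2.partner p)) / 2 * ((if p ∈ U then (1 : ℝ) else 0) * (if M.2.partner p ∈ U then (1 : ℝ) else 0)) := by
  have hπ : ∀ q, M.2.partner (M.2.partner q) = q := M.2.partner_partner
  have hre : ∑ p, v (M.2.partner p) * ((if p ∈ U then (1 : ℝ) else 0) * (if M.2.partner p ∈ U then (1 : ℝ) else 0)) =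
      ∑ p, v p * ((if p ∈ U then (1 : ℝ) else 0) * (if M.2.partner p ∈ U then (1 : ℝ) else 0)) := by
    have hπinv : Function.Involutive M.2.partner := hπ
    rw [← Equiv.sum_comp hπinv.toPerm (fun p => v p * ((if p ∈ U then (1 : ℝ) else 0) * (if M.2.partner p ∈ U then (1 : ℝ) else 0)))]
    refine sum_congr rfl fun p _ => ?_
    simp only [Function.Involutive.coe_toPerm, hπ]
    ring
  have : ∑ p, (v p + v (M.2.partner p)) / 2 * ((if p ∈ U then (1 : ℝ) else 0) * (if M.2.partner p ∈ U then (1 : ℝ) else 0)) =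
      (∑ p, v p * ((if p ∈ U then (1 : ℝ) else 0) * (if M.2.partner p ∈ U then (1 : ℝ) else 0)) +
        ∑ p, v (M.2.partner p) * ((if p ∈ U then (1 : ℝ) else 0) * (if M.2.partner p ∈ U then (1 : ℝ) else 0))) / 2 := by
    rw [← sum_add_distrib, sum_div]
    refine sum_congr rfl fun p _ => ?_; ring
  rw [this, hre]; ring

/-! ### §2 The 𝒜₁ rung for `H`-symmetric amplitudes -/

/-- `dq n ≥ 4` once `n ≥ 256`. [cite: CoppersmithRivlin1992, Thm. (p. 970)] -/
theorem four_le_dq {n : ℕ} (hn : 256 ≤ n) : 4 ≤ dq n := by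
  unfold dq
  exact Nat.le_sqrt.2 (Nat.le_sqrt.2 (by omega))

set_option maxHeartbeats 400000 in -- the assembly instantiates bricks 101, 108 and 145 in one context
/-- **THE 𝒜₁ RUNG WITH `H`-SYMMETRIC AMPLITUDES (brick 146).** For some `a > 0` and all large even `n`: for every balanced exact design `(t, C, w)` of
degree `dq n` on levels `≤ Tq n` with `Σ|w| ≤ 20`, every balanced block `2|H| = n`, every mask `0 ≤ ψ ≤ G`, every degree-one factor
`B_U = Σ_p x_p(U)β_p` (`β_p ∈ ℝ^{r×m}`) with `B_UB_Uᵀ ⪯ I` on the `t`-cuts and every matching side `0 ⪯ Y_M ⪯ I`: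
`Σ_{U,M} W(U,M)·ψ(|U∩H|)·tr(B_UB_UᵀY_M) ≤ 6·10⁷·G·n⁶·(e^{−a·dq n} + 2^{−⌊n/40⌋} + √P_{dq n−4})·r`.
[cite: GriblingDelaatLaurent2019, §5] [cite: Rothvoss2017, §2 and Lemma 7 (PDF pp. 5–8)] [cite: KeevashLifshitz2023, Thm. 1.8] -/
theorem hSymmetric_amplitudeOne_value_le :
    ∃ a : ℝ, 0 < a ∧ ∃ n₀ : ℕ, ∀ n : ℕ, n₀ ≤ n → Even n → ∀ {t : ℕ} {C : Finset ℕ} {w : ℕ → ℝ},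
    IsBalancedDesign n t (Tq n) (dq n) 20 C w →
    ∀ (H : Finset (Fin n)), 2 * H.card = n →
    ∀ (ψ : ℤ → ℝ) {G : ℝ}, 0 ≤ G → (∀ x, 0 ≤ ψ x) → (∀ x, ψ x ≤ G) →
    ∀ {r m : ℕ} (β : Fin n → Matrix (Fin r) (Fin m) ℝ),
    (∀ U : OddSet n, U.1.card = t →
      (1 - (∑ p, (if p ∈ U.1 then (1 : ℝ) else 0) • β p) * (∑ p, (if p ∈ U.1 then (1 : ℝ) else 0) • β p)ᵀ).PosSemidef) →
    ∀ (Y : PMatch n → Matrix (Fin r) (Fin r) ℝ), (∀ M, (Y M).PosSemidef ∧ (1 - Y M).PosSemidef) →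
    ∑ U : OddSet n, ∑ M : PMatch n, levelWeight n t C w U M *
        (ψ ((U.1 ∩ H).card : ℤ) *
          ((∑ p, (if p ∈ U.1 then (1 : ℝ) else 0) • β p) * (∑ p, (if p ∈ U.1 then (1 : ℝ) else 0) • β p)ᵀ * Y M).trace) ≤
      6 * 10 ^ 7 * G * (n : ℝ) ^ 6 * (Real.exp (-(a * dq n)) + (1 / 2 : ℝ) ^ (n / 40) +
        Real.sqrt (∏ i ∈ range ((dq n - 4) / 2 + 1), ((2 * i + 1 : ℝ) / ((n : ℝ) - 2 * i)))) * r := by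
  classical
  obtain ⟨a, ha, n₁, h145⟩ := allDirections_designValue_le
  refine ⟨a, ha, max n₁ 256, ?_⟩
  intro n hn hev t C w hdes H hH ψ G hG0 hψ0 hψG r m β hB Y hY
  have hn₁ : n₁ ≤ n := le_trans (le_max_left _ _) hn
  have hn256 : 256 ≤ n := le_trans (le_max_right _ _) hn
  obtain ⟨-, -, hdqT, -⟩ := dq_Tq_facts (show 16 ≤ n by omega)
  have hD4 : 4 ≤ dq n := four_le_dq hn256
  have hex : IsExactDesign n t (Tq n) (dq n) 20 C w := hdes.1
  have hbal : n ≤ 4 * t := hdes.2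
  obtain ⟨c', hc'⟩ := hex.1
  subst hc'
  have htn : 2 * (2 * c' + 1) + 2 ≤ n := hex.2.1
  have hTt : Tq n ≤ 2 * c' + 1 := hex.2.2.1
  have ht0 : 0 < 2 * c' + 1 := by omega
  have htn' : 2 * c' + 1 < n := by omega
  have hDc : dq n ≤ 2 * c' := by omega
  have hvar : ∑ c ∈ C, |w c| ≤ 20 := hex.2.2.2.2.2.2
  -- a `t`-cut exists
  obtain ⟨c₀, hc₀⟩ := nonempty_of_exact hex.exact
  obtain ⟨q₀, hq₀⟩ := (hex.2.2.2.1 c₀ hc₀).2.2.2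
  have hT : 0 < (univ.filter fun U : OddSet n => U.1.card = 2 * c' + 1).card :=
    card_pos.2 ⟨q₀.1, mem_filter.2 ⟨mem_univ _, (mem_Qset_iff.1 hq₀).1⟩⟩
  -- the error scale
  have hP0 : 0 ≤ Real.sqrt (∏ i ∈ range ((dq n - 4) / 2 + 1), ((2 * i + 1 : ℝ) / ((n : ℝ) - 2 * i))) := Real.sqrt_nonneg _
  have hE0 : 0 ≤ Real.exp (-(a * dq n)) + (1 / 2 : ℝ) ^ (n / 40) := by positivity
  have hn1 : (1 : ℝ) ≤ n := by exact_mod_cast (show 1 ≤ n by omega)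
  -- the degenerate case `G = 0`
  rcases eq_or_lt_of_le hG0 with hG | hG
  · have hψ : ∀ x, ψ x = 0 := fun x => le_antisymm (by rw [hG]; exact hψG x) (hψ0 x)
    simp only [hψ, zero_mul, mul_zero, sum_const_zero, ← hG]
    positivity
  -- §1: the per-matching cube maximisers and CG_1
  have hmaxex : ∀ M : PMatch n, ∃ g₀ : Fin n → ℝ, (∀ p, |g₀ p| ≤ 1) ∧ ∀ g : Fin n → ℝ, (∀ p, |g p| ≤ 1) →
      ∑ U : OddSet n, levelWeight n (2 * c' + 1) C w U M * (ψ ((U.1 ∩ H).card : ℤ) *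
          (∑ p, g p * (if p ∈ U.1 then (1 : ℝ) else 0)) ^ 2) ≤
        ∑ U : OddSet n, levelWeight n (2 * c' + 1) C w U M * (ψ ((U.1 ∩ H).card : ℤ) *
          (∑ p, g₀ p * (if p ∈ U.1 then (1 : ℝ) else 0)) ^ 2) :=
    fun M => exists_cube_max _ (continuous_linearForm (levelWeight n (2 * c' + 1) C w) M (fun U => ψ ((U.1 ∩ H).card : ℤ)))
  choose g₀ hg₀1 hg₀max using hmaxex
  have hε0 : ∀ M : PMatch n, 0 ≤ ∑ U : OddSet n, levelWeight n (2 * c' + 1) C w U M * (ψ ((U.1 ∩ H).card : ℤ) *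
      (∑ p, g₀ M p * (if p ∈ U.1 then (1 : ℝ) else 0)) ^ 2) := fun M => by
    have h := hg₀max M 0 (fun p => by simp)
    simpa using h
  have hCG : ∀ (M : PMatch n) (g : Fin n → ℝ),
      ∑ U : OddSet n, levelWeight n (2 * c' + 1) C w U M * (ψ ((U.1 ∩ H).card : ℤ) *
          (∑ p, g p * (if p ∈ U.1 then (1 : ℝ) else 0)) ^ 2) ≤
        (∑ U : OddSet n, levelWeight n (2 * c' + 1) C w U M * (ψ ((U.1 ∩ H).card : ℤ) *
          (∑ p, g₀ M p * (if p ∈ U.1 then (1 : ℝ) else 0)) ^ 2)) * ∑ p, g p ^ 2 :=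
    fun M g => CG1_of_cubeMax _ M _ (g₀ M) (hg₀max M) g
  -- brick 108: the value on the amplitude class
  have h108 := value_amplitudeOne_le_of_CG1_dim ht0 htn' hT (levelWeight n (2 * c' + 1) C w)
    (fun U => ψ ((U.1 ∩ H).card : ℤ)) β hB Y hY _ hCG
  have hεsum : ∑ M : PMatch n, max (∑ U : OddSet n, levelWeight n (2 * c' + 1) C w U M * (ψ ((U.1 ∩ H).card : ℤ) *
      (∑ p, g₀ M p * (if p ∈ U.1 then (1 : ℝ) else 0)) ^ 2)) 0 =
      ∑ M : PMatch n, ∑ U : OddSet n, levelWeight n (2 * c' + 1) C w U M * (ψ ((U.1 ∩ H).card : ℤ) *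
      (∑ p, g₀ M p * (if p ∈ U.1 then (1 : ℝ) else 0)) ^ 2) :=
    sum_congr rfl fun M _ => max_eq_left (hε0 M)
  rw [hεsum] at h108
  -- brick 101: linear forms ↦ containment forms (mask `ψ/G ∈ [0,1]`)
  have hf1 : ∀ U : OddSet n, |ψ ((U.1 ∩ H).card : ℤ) / G| ≤ 1 := fun U => by
    rw [abs_div, abs_of_pos hG, div_le_one hG, abs_of_nonneg (hψ0 _)]; exact hψG _
  have h101 := value_sq_sub_containment_abs_le hev hex hDc hD4 (fun U => ψ ((U.1 ∩ H).card : ℤ) / G) hf1 g₀ hg₀1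
  have hscale : ∀ (F : PMatch n → OddSet n → ℝ),
      ∑ M : PMatch n, ∑ U : OddSet n, levelWeight n (2 * c' + 1) C w U M * (ψ ((U.1 ∩ H).card : ℤ) / G * F M U) =
      (∑ M : PMatch n, ∑ U : OddSet n, levelWeight n (2 * c' + 1) C w U M * (ψ ((U.1 ∩ H).card : ℤ) * F M U)) / G := by
    intro F
    rw [sum_div]; refine sum_congr rfl fun M _ => ?_
    rw [sum_div]; refine sum_congr rfl fun U _ => ?_
    field_simp
  rw [hscale, hscale, ← sub_div, abs_div, abs_of_pos hG, div_le_iff₀ hG] at h101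
  have hlin := (abs_sub_le_iff.1 h101).1
  -- brick 145 on the pair-symmetrised maximising field
  have h145' := h145 n hn₁ hev hdes H hH ψ hG0 hψ0 hψG (fun M p => (g₀ M p + g₀ M (M.2.partner p)) / 2)
    (fun M p => by
      have h1 := abs_le.1 (hg₀1 M p); have h2 := abs_le.1 (hg₀1 M (M.2.partner p))
      rw [abs_le]; constructor <;> linarith)
    (fun M p => by simp only [M.2.partner_partner]; ring)
  have hsymm : ∑ M : PMatch n, ∑ U : OddSet n, levelWeight n (2 * c' + 1) C w U M * (ψ ((U.1 ∩ H).card : ℤ) *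
      (∑ p, g₀ M p * ((if p ∈ U.1 then (1 : ℝ) else 0) * (if M.2.partner p ∈ U.1 then (1 : ℝ) else 0))) ^ 2) =
      ∑ M : PMatch n, ∑ U : OddSet n, levelWeight n (2 * c' + 1) C w U M * (ψ ((U.1 ∩ H).card : ℤ) *
      (∑ p, (g₀ M p + g₀ M (M.2.partner p)) / 2 *
        ((if p ∈ U.1 then (1 : ℝ) else 0) * (if M.2.partner p ∈ U.1 then (1 : ℝ) else 0))) ^ 2) :=
    sum_congr rfl fun M _ => Fintype.sum_congr _ _ fun U => by rw [containment_pairSymm M U.1 (g₀ M)]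
  rw [hsymm] at hlin
  -- the balance ratio `n(n−1)/(t(n−t)) ≤ 8`
  have htr : (n : ℝ) ≤ 4 * ((2 * c' + 1 : ℕ) : ℝ) := by exact_mod_cast hbal
  have htn'' : 2 * ((2 * c' + 1 : ℕ) : ℝ) + 2 ≤ n := by exact_mod_cast htn
  have htpos : (0 : ℝ) < ((2 * c' + 1 : ℕ) : ℝ) * ((n : ℝ) - (2 * c' + 1 : ℕ)) := by
    apply mul_pos <;> [exact_mod_cast ht0; linarith]
  have hratio : (n : ℝ) * ((n : ℝ) - 1) / (((2 * c' + 1 : ℕ) : ℝ) * ((n : ℝ) - (2 * c' + 1 : ℕ))) ≤ 8 := by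
    rw [div_le_iff₀ htpos]; nlinarith
  -- assemble
  have hP := mul_nonneg (mul_nonneg (by norm_num : (0 : ℝ) ≤ 3) (pow_nonneg (Nat.cast_nonneg n) 4)) (mul_nonneg
    (sum_nonneg fun c (_ : c ∈ C) => abs_nonneg (w c)) hP0)
  have hL : ∑ M : PMatch n, ∑ U : OddSet n, levelWeight n (2 * c' + 1) C w U M * (ψ ((U.1 ∩ H).card : ℤ) *
      (∑ p, g₀ M p * (if p ∈ U.1 then (1 : ℝ) else 0)) ^ 2) ≤
      7 * 10 ^ 6 * G * (n : ℝ) ^ 6 * (Real.exp (-(a * dq n)) + (1 / 2 : ℝ) ^ (n / 40)) +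
        3 * (n : ℝ) ^ 4 * (20 * Real.sqrt (∏ i ∈ range ((dq n - 4) / 2 + 1), ((2 * i + 1 : ℝ) / ((n : ℝ) - 2 * i)))) * G := by
    have hw : 3 * (n : ℝ) ^ 4 * ((∑ c ∈ C, |w c|) * Real.sqrt (∏ i ∈ range ((dq n - 4) / 2 + 1),
        ((2 * i + 1 : ℝ) / ((n : ℝ) - 2 * i)))) * G ≤
        3 * (n : ℝ) ^ 4 * (20 * Real.sqrt (∏ i ∈ range ((dq n - 4) / 2 + 1), ((2 * i + 1 : ℝ) / ((n : ℝ) - 2 * i)))) * G := by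
      refine mul_le_mul_of_nonneg_right (mul_le_mul_of_nonneg_left (mul_le_mul_of_nonneg_right hvar hP0) (by positivity)) hG.le
    linarith
  have hLnn : 0 ≤ ∑ M : PMatch n, ∑ U : OddSet n, levelWeight n (2 * c' + 1) C w U M * (ψ ((U.1 ∩ H).card : ℤ) *
      (∑ p, g₀ M p * (if p ∈ U.1 then (1 : ℝ) else 0)) ^ 2) := sum_nonneg fun M _ => hε0 M
  refine h108.trans ?_
  have hr0 : (0 : ℝ) ≤ r := Nat.cast_nonneg _
  calc (∑ M : PMatch n, ∑ U : OddSet n, levelWeight n (2 * c' + 1) C w U M * (ψ ((U.1 ∩ H).card : ℤ) *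
        (∑ p, g₀ M p * (if p ∈ U.1 then (1 : ℝ) else 0)) ^ 2)) *
        ((r : ℝ) * ((n : ℝ) * ((n : ℝ) - 1)) / (((2 * c' + 1 : ℕ) : ℝ) * ((n : ℝ) - (2 * c' + 1 : ℕ))))
      = (∑ M : PMatch n, ∑ U : OddSet n, levelWeight n (2 * c' + 1) C w U M * (ψ ((U.1 ∩ H).card : ℤ) *
        (∑ p, g₀ M p * (if p ∈ U.1 then (1 : ℝ) else 0)) ^ 2)) * (r : ℝ) *
        ((n : ℝ) * ((n : ℝ) - 1) / (((2 * c' + 1 : ℕ) : ℝ) * ((n : ℝ) - (2 * c' + 1 : ℕ)))) := by ring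
    _ ≤ (7 * 10 ^ 6 * G * (n : ℝ) ^ 6 * (Real.exp (-(a * dq n)) + (1 / 2 : ℝ) ^ (n / 40)) +
        3 * (n : ℝ) ^ 4 * (20 * Real.sqrt (∏ i ∈ range ((dq n - 4) / 2 + 1), ((2 * i + 1 : ℝ) / ((n : ℝ) - 2 * i)))) * G) *
        (r : ℝ) * 8 := by
          refine mul_le_mul (mul_le_mul_of_nonneg_right hL hr0) hratio (by positivity) (by positivity)
    _ ≤ 6 * 10 ^ 7 * G * (n : ℝ) ^ 6 * (Real.exp (-(a * dq n)) + (1 / 2 : ℝ) ^ (n / 40) +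
        Real.sqrt (∏ i ∈ range ((dq n - 4) / 2 + 1), ((2 * i + 1 : ℝ) / ((n : ℝ) - 2 * i)))) * r := by
          have hn46 : (n : ℝ) ^ 4 ≤ (n : ℝ) ^ 6 := pow_le_pow_right₀ hn1 (by norm_num)
          nlinarith [mul_nonneg (mul_nonneg hG.le (pow_nonneg (Nat.cast_nonneg n) 6)) hE0,
            mul_nonneg (mul_nonneg hG.le (pow_nonneg (Nat.cast_nonneg n) 6)) hP0,
            mul_nonneg (mul_nonneg hG.le (sub_nonneg.2 hn46)) hP0, hr0,
            mul_nonneg (mul_nonneg (mul_nonneg hG.le (pow_nonneg (Nat.cast_nonneg n) 6)) hE0) hr0,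
            mul_nonneg (mul_nonneg (mul_nonneg hG.le (pow_nonneg (Nat.cast_nonneg n) 6)) hP0) hr0,
            mul_nonneg (mul_nonneg (mul_nonneg hG.le (sub_nonneg.2 hn46)) hP0) hr0]

end Summit.PneNP.PneNP.Theorems.ChebyshevTracialDesignHSymmetricAmplitudeOne

end
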